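import Mathlib.Geometry.Manifold.ChartedSpace
import Mathlib.Analysis.InnerProductSpace.PiL2
import Literature.AlgebraicTopology.SingularHomology.SingularChains
import HarnessLib

/-!
# Homology of non-compact manifolds in degrees `≥ n` (Hatcher Prop. 3.29) — named fact

A. Hatcher, *Algebraic Topology*, CUP 2002, §3.3, p. 239, Proposition 3.29:
"If `M` is a connected noncompact `n`-manifold, then `Hᵢ(M; R) = 0` for `i ≥ n`."
Here (Hatcher, p. 231) an `n`-manifold is a Hausdorff space in which each point has an open
neighbourhood homeomorphic to `ℝⁿ` (no second countability is assumed), and `R` is the commutative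
coefficient ring of §3.3. The printed proof uses Lemma 3.27 (local-to-compact extension of sections
of the orientation cover `M_R`, and `Hᵢ(M | A; R) = 0` for `i > n`, `A` compact), excision and the
long exact sequence of the triple `(M, U ∪ V, V)` for `U ⊇ |z|` relatively compact, `V = M ∖ Ū`;
none of Lemma 3.27, excision or Mayer–Vietoris is proved in the pinned Mathlib or in `Literature`
(they are named facts in `Literature.AlgebraicTopology.SingularHomology.{ExcisionMayerVietoris,
Orientation, FundamentalClass}`), so the proposition is recorded here as a NAMED FACT
(D-0014: nothing is asserted; users take `(h : Literature.isZero_singularHomology_of_noncompactSpace R X n)`).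

It is the homological input of `Literature.Topology.FourManifolds.compactSpace_of_homotopyEquiv_sphere_four`
(`Literature.Topology.FourManifolds.HomotopyS4Compact`): a manifold homotopy equivalent to `Sⁿ`
has `Hₙ ≅ ℤ ≠ 0`, hence is compact.

## Conventions

As in `Literature.AlgebraicTopology.SingularHomology.SingularChains`: `X : Type u` unbundled,
coefficients `R : Type v` `[CommRing R]`, `Hᵢ(X; R) = Literature.singularHomology R R X i :
ModuleCat.{max u v} R`. Topological `n`-manifold = `[T2Space X] [ChartedSpace (EuclideanSpace ℝ
(Fin n)) X]` exactly as in `Mathlib/Geometry/Manifold/PoincareConjecture.lean` and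
`Literature.AlgebraicTopology.SingularHomology.FundamentalClass`; the manifold hypotheses appear
inside the `Prop`, the space `X` and the dimension `n` are parameters (same shape as
`Literature.AlgebraicTopology.SingularHomology.isZero_singularHomology_of_lt`).

## Main statements

* `Literature.isZero_singularHomology_of_noncompactSpace R X n` (NAMED FACT, Hatcher Prop. 3.29).
* `Literature.AlgebraicTopology.SingularHomology.isZero_singularHomology_top_of_noncompactSpace`: the case `i = n`, derived.

## References

* A. Hatcher, *Algebraic Topology*, CUP 2002, §3.3, Prop. 3.29 (p. 239), Lemma 3.27 (p. 236).
-/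

noncomputable section

open CategoryTheory Limits

universe u v

namespace Literature.AlgebraicTopology.SingularHomology

variable (R : Type v) [CommRing R]
variable (X : Type u) [TopologicalSpace X]

/-- NAMED FACT (Hatcher 2002, Prop. 3.29, p. 239). If `X` is a connected, non-compact topological
`n`-manifold (Hausdorff, every point has a neighbourhood homeomorphic to an open subset of `ℝⁿ`),
then `Hᵢ(X; R) = 0` for every `i ≥ n` and every commutative coefficient ring `R`.
Users take `(h : isZero_singularHomology_of_noncompactSpace R X n)`.
[cite: HatcherAT2002, Prop. 3.29] -/
def isZero_singularHomology_of_noncompactSpace (n : ℕ) : Prop :=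
  ∀ [T2Space X] [ChartedSpace (EuclideanSpace ℝ (Fin n)) X] [ConnectedSpace X] [NoncompactSpace X]
    {i : ℕ} (_ : n ≤ i), IsZero (singularHomology R R X i)

variable {R X} in
/-- The top-degree case of Hatcher 2002, Prop. 3.29: a connected non-compact topological
`n`-manifold has `Hₙ(X; R) = 0`, GIVEN the named fact
`isZero_singularHomology_of_noncompactSpace R X n`. [cite: HatcherAT2002, Prop. 3.29] -/
theorem isZero_singularHomology_top_of_noncompactSpace {n : ℕ}
    (h : isZero_singularHomology_of_noncompactSpace R X n)
    [T2Space X] [ChartedSpace (EuclideanSpace ℝ (Fin n)) X] [ConnectedSpace X] [NoncompactSpace X] :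
    IsZero (singularHomology R R X n) :=
  h le_rfl

end Literature.AlgebraicTopology.SingularHomology

end
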